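import Literature.Computability.Complexity.ScaledPCPTapeFP
import HarnessLib

/-!
# The scaled PCP verifier reads `O(n)`-bit positions

Literature / complexity toolkit, companion of `ScaledPCPVerifier.lean`: the arithmetic of the
CRUCIAL SCALING of the Babai–Fortnow–Lund / BFLS verifier for a machine running in time
`T n ≤ 2^{c_T n + c_T}` — the base `h = Θ(n)` makes the dimensions `kt, kJ = O(n / log n)` (digits of
`T n` in base `h`), while the prime is polynomial (`p ≤ 420 · U(n)⁷`, `ScaledPCPParamsFP.lean`), so that
`p^{O(K + m)} = 2^{O(n)}`: the honest proof table has length `2^{O(n)}` (hence is an `FE` object) and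
every position the verifier reads has `O(n)` bits. Contents:

* `tN n = ⌊log₂ h⌋` (`three_le_tN`, `two_pow_tN_le`, `lt_two_pow_tN_succ`);
* `kt_mul_tN_le`, `kJ_mul_tN_le` (`(kt - 1) ⌊log₂ h⌋ ≤ c_T n + c_T`, …), `log_pN_le`
  (`log₂ p ≤ 7 ⌊log₂ h⌋ + c₁ + 7`);
* **`expo_le`**: `(2K + m + 7)(log₂ p + 1) ≤ a_N n + a_N` for the explicit constant `aN`, and
  **`pow_pN_le`**: `p^{2K + m + 7} ≤ 2^{a_N n + a_N}` (also `hN_pow_KN_le`, `T_le_budget`, `S_le_budget`);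
* **`queries_lt`**: every position in `queriesOf M T x ρ` is `< p^{2K + m + 7}`.

All proved; no named fact.

## References

* L. Babai, L. Fortnow, L. Levin, M. Szegedy, *Checking computations in polylogarithmic time*,
  STOC 1991, §5 (parameters: `|H| = Θ(log n)`-size alphabets make the encoding length near-linear)
  [BFLS1991].
* H. Buhrman, L. Fortnow, A. Pavan, *Some results on derandomization*, Theory Comput. Syst. 38
  (2005), Thm. 3.3 ("the proof is computable in time `2^{O(n)}`") [BuhrmanFortnowPavan2004].
-/

noncomputable section

namespace Literature.Computability.Complexity

namespace ScaledPCP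

open Turing Tableau TableauCSP AlgebraicPCP _root_.Computability

attribute [local instance] Turing.FinTM2.kFin Turing.FinTM2.ΛFin Turing.FinTM2.σFin
  Turing.FinTM2.Γk₀Fin

section Expo

variable (M : TM2ComputableAux Bool Bool) (T : ℕ → ℕ) (cT : ℕ) (hTb : ∀ n, T n ≤ 2 ^ (cT * n + cT))

local notation "d" => dM M

/-! ### `⌊log₂ h⌋` -/

/-- `t = ⌊log₂ h⌋`. [folklore] -/
def tN (n : ℕ) : ℕ := Nat.log 2 (hN M n)

/-- `3 ≤ t` (`h ≥ 8`). [folklore] -/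
theorem three_le_tN (n : ℕ) : 3 ≤ tN M n := by
  unfold tN
  exact Nat.le_log_of_pow_le (by norm_num) (by unfold hN; omega)

/-- `h < p`. [folklore] -/
theorem hN_lt_pN' (n : ℕ) : hN M n < pN M T n :=
  lt_of_le_of_lt (by unfold BN; omega) (BN_lt_pN M T n)

/-- `2^t ≤ h`. [folklore] -/
theorem two_pow_tN_le (n : ℕ) : 2 ^ tN M n ≤ hN M n := Nat.pow_log_le_self 2 (by unfold hN; omega)

/-- `h < 2^{t+1}`. [folklore] -/
theorem lt_two_pow_tN_succ (n : ℕ) : hN M n < 2 ^ (tN M n + 1) := Nat.lt_pow_succ_log_self (by norm_num) _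

/-- `t < h`. [folklore] -/
theorem tN_lt_hN (n : ℕ) : tN M n < hN M n := Nat.log_lt_self 2 (by unfold hN; omega)

/-- From `h^j ≤ 2^E`: `j t ≤ E`. [folklore] -/
theorem mul_tN_le_of_pow_le {n j E : ℕ} (h : hN M n ^ j ≤ 2 ^ E) : j * tN M n ≤ E := by
  have h1 : (2 ^ tN M n) ^ j ≤ 2 ^ E := (Nat.pow_le_pow_left (two_pow_tN_le M n) j).trans h
  rw [← pow_mul, Nat.pow_le_pow_iff_right (by norm_num)] at h1
  rwa [Nat.mul_comm] at h1

include hTb in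
/-- **`(kt - 1) t ≤ c_T n + c_T`.** [folklore] -/
theorem kt_mul_tN_le (n : ℕ) : (ktN M T n - 1) * tN M n ≤ cT * n + cT := by
  unfold ktN
  rw [Nat.add_sub_cancel]
  rcases Nat.eq_zero_or_pos (T n) with h0 | hpos
  · rw [h0, Nat.log_zero_right, Nat.zero_mul]; exact Nat.zero_le _
  · exact mul_tN_le_of_pow_le M ((Nat.pow_log_le_self _ hpos.ne').trans (hTb n))

include hTb in
/-- `S₁ ≤ 2^{2n + 2 + 4d + (c_T n + c_T)}`. [folklore] -/
theorem S1N_le_two_pow (n : ℕ) : S1N M T n ≤ 2 ^ (2 * n + 2 + 4 * d + (cT * n + cT)) := by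
  unfold S1N S1 NN
  have h1 : 2 * n + 2 + 0 + d * T n + 3 * d ≤ (2 * n + 2 + 4 * d) * 2 ^ (cT * n + cT) := by
    have : 1 ≤ 2 ^ (cT * n + cT) := Nat.one_le_two_pow
    have := hTb n
    nlinarith
  refine h1.trans ?_
  calc (2 * n + 2 + 4 * d) * 2 ^ (cT * n + cT) ≤ 2 ^ (2 * n + 2 + 4 * d) * 2 ^ (cT * n + cT) :=
        Nat.mul_le_mul_right _ (Nat.lt_two_pow_self).le
    _ = 2 ^ (2 * n + 2 + 4 * d + (cT * n + cT)) := (pow_add 2 _ _).symm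

include hTb in
/-- **`(kJ - 1) t ≤ 2n + 2 + 4d + c_T n + c_T`.** [folklore] -/
theorem kJ_mul_tN_le (n : ℕ) : (kJN M T n - 1) * tN M n ≤ 2 * n + 2 + 4 * d + (cT * n + cT) := by
  unfold kJN
  rw [Nat.add_sub_cancel]
  have hpos : 0 < S1N M T n := by unfold S1N S1 NN; omega
  exact mul_tN_le_of_pow_le M ((Nat.pow_log_le_self _ hpos.ne').trans (S1N_le_two_pow M T cT hTb n))

/-- The constant `c₁ = ⌊log₂ (420 c₀⁷)⌋ + 1`. [folklore] -/
def c1 : ℕ := Nat.log 2 (420 * c0 M cT ^ 7) + 1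

include hTb in
/-- **`log₂ p ≤ 7 t + c₁ + 7`.** [folklore] -/
theorem log_pN_le (n : ℕ) : Nat.log 2 (pN M T n) ≤ 7 * tN M n + c1 M cT + 7 := by
  have hB := BN_le M T cT hTb n
  have hp : pN M T n ≤ 420 * UU M cT n ^ 7 := (pN_le M T n).trans (by omega)
  have hU : UU M cT n ≤ c0 M cT * hN M n := by
    unfold UU hN; exact Nat.mul_le_mul_left _ (by omega)
  have h1 : pN M T n ≤ (420 * c0 M cT ^ 7) * hN M n ^ 7 := by
    calc pN M T n ≤ 420 * UU M cT n ^ 7 := hp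
      _ ≤ 420 * (c0 M cT * hN M n) ^ 7 := Nat.mul_le_mul_left _ (Nat.pow_le_pow_left hU 7)
      _ = (420 * c0 M cT ^ 7) * hN M n ^ 7 := by ring
  have h2 : 420 * c0 M cT ^ 7 < 2 ^ c1 M cT := Nat.lt_pow_succ_log_self (by norm_num) _
  have h3 : hN M n ^ 7 < 2 ^ (7 * tN M n + 7) := by
    calc hN M n ^ 7 < (2 ^ (tN M n + 1)) ^ 7 := Nat.pow_lt_pow_left (lt_two_pow_tN_succ M n) (by norm_num)
      _ = 2 ^ (7 * tN M n + 7) := by rw [← pow_mul]; ring_nf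
  have h4 : pN M T n < 2 ^ (7 * tN M n + c1 M cT + 7) := by
    calc pN M T n ≤ (420 * c0 M cT ^ 7) * hN M n ^ 7 := h1
      _ < 2 ^ c1 M cT * 2 ^ (7 * tN M n + 7) := Nat.mul_lt_mul'' h2 h3
      _ = 2 ^ (7 * tN M n + c1 M cT + 7) := by rw [← pow_add]; ring_nf
  exact Nat.le_of_lt_succ ((Nat.log_lt_of_lt_pow (pN_prime M T n).ne_zero h4).trans_le (Nat.le_succ _))

/-- The constant of the linear exponent bound. [folklore] -/
def aN : ℕ := (c1 M cT + 14) * ((4 * d + 5) * ((2 * cT + 34) + (2 * cT + 4 * d + 16 * cQ M + 18)) + 8 * (24 + 8 * cQ M))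

include hTb in
/-- **The exponent is linear**: `(2K + m + 7)(log₂ p + 1) ≤ a_N n + a_N`.
[cite: BFLS1991, §5] [cite: BuhrmanFortnowPavan2004, Thm. 3.3] -/
theorem expo_le (n : ℕ) : (2 * KN M T n + mN M T n + 7) * (Nat.log 2 (pN M T n) + 1) ≤ aN M cT * n + aN M cT := by
  have ht4 := three_le_tN M n
  have hth := tN_lt_hN M n
  have hkt := kt_mul_tN_le M T cT hTb n
  have hkJ := kJ_mul_tN_le M T cT hTb n
  have hlp := log_pN_le M T cT hTb n
  have hh : hN M n = 16 * n + 8 * cQ M + 8 := rfl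
  obtain ⟨kt', hkt'⟩ : ∃ k, ktN M T n = k + 1 := ⟨ktN M T n - 1, by unfold ktN; omega⟩
  obtain ⟨kJ', hkJ'⟩ : ∃ k, kJN M T n = k + 1 := ⟨kJN M T n - 1, by unfold kJN; omega⟩
  have e1 : KN M T n = ktN M T n + ktN M T n + (2 * d + 1) * kJN M T n := rfl
  have e2 : mN M T n = ktN M T n + kJN M T n + 1 := rfl
  rw [e1, e2]
  rw [hkt'] at hkt ⊢
  rw [hkJ'] at hkJ ⊢
  rw [Nat.add_sub_cancel] at hkt hkJ
  -- `S t ≤ α n + β` for `S = kt + kJ`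
  have hS : (kt' + 1 + (kJ' + 1)) * tN M n ≤ (2 * cT + 34) * n + (2 * cT + 4 * d + 16 * cQ M + 18) := by
    have e : (kt' + 1 + (kJ' + 1)) * tN M n = kt' * tN M n + kJ' * tN M n + 2 * tN M n := by ring
    have hth' : tN M n ≤ 16 * n + 8 * cQ M + 8 := by rw [← hh]; exact hth.le
    rw [e]; linarith
  -- `2K + m + 7 ≤ (4d + 5) S + 8`
  have hE : 2 * (kt' + 1 + (kt' + 1) + (2 * d + 1) * (kJ' + 1)) + (kt' + 1 + (kJ' + 1) + 1) + 7 ≤ (4 * d + 5) * (kt' + 1 + (kJ' + 1)) + 8 := by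
    nlinarith
  -- `log₂ p + 1 ≤ (c₁ + 14) t`
  have hL : Nat.log 2 (pN M T n) + 1 ≤ (c1 M cT + 14) * tN M n := by nlinarith
  have h1 : (4 * d + 5) * ((2 * cT + 34) * n + (2 * cT + 4 * d + 16 * cQ M + 18)) ≤
      (4 * d + 5) * (((2 * cT + 34) + (2 * cT + 4 * d + 16 * cQ M + 18)) * (n + 1)) := Nat.mul_le_mul_left _ (by nlinarith)
  have h2 : 8 * (16 * n + 8 * cQ M + 8) ≤ 8 * ((24 + 8 * cQ M) * (n + 1)) := Nat.mul_le_mul_left _ (by nlinarith)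
  calc (2 * (kt' + 1 + (kt' + 1) + (2 * d + 1) * (kJ' + 1)) + (kt' + 1 + (kJ' + 1) + 1) + 7) * (Nat.log 2 (pN M T n) + 1)
      ≤ ((4 * d + 5) * (kt' + 1 + (kJ' + 1)) + 8) * ((c1 M cT + 14) * tN M n) := Nat.mul_le_mul hE hL
    _ = (c1 M cT + 14) * ((4 * d + 5) * ((kt' + 1 + (kJ' + 1)) * tN M n) + 8 * tN M n) := by ring
    _ ≤ (c1 M cT + 14) * ((4 * d + 5) * ((2 * cT + 34) * n + (2 * cT + 4 * d + 16 * cQ M + 18)) + 8 * (16 * n + 8 * cQ M + 8)) :=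
        Nat.mul_le_mul_left _ (Nat.add_le_add (Nat.mul_le_mul_left _ hS) (Nat.mul_le_mul_left _ (by omega)))
    _ ≤ (c1 M cT + 14) * ((4 * d + 5) * (((2 * cT + 34) + (2 * cT + 4 * d + 16 * cQ M + 18)) * (n + 1)) + 8 * ((24 + 8 * cQ M) * (n + 1))) :=
        Nat.mul_le_mul_left _ (Nat.add_le_add h1 h2)
    _ = aN M cT * n + aN M cT := by unfold aN; ring

include hTb in
/-- **`p^{2K + m + 7} ≤ 2^{a_N n + a_N}`**: the proof table has length `2^{O(n)}`.
[cite: BuhrmanFortnowPavan2004, Thm. 3.3] -/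
theorem pow_pN_le (n : ℕ) : pN M T n ^ (2 * KN M T n + mN M T n + 7) ≤ 2 ^ (aN M cT * n + aN M cT) := by
  have h1 : pN M T n < 2 ^ (Nat.log 2 (pN M T n) + 1) := Nat.lt_pow_succ_log_self (by norm_num) _
  calc pN M T n ^ (2 * KN M T n + mN M T n + 7) ≤ (2 ^ (Nat.log 2 (pN M T n) + 1)) ^ (2 * KN M T n + mN M T n + 7) :=
        Nat.pow_le_pow_left h1.le _
    _ = 2 ^ ((2 * KN M T n + mN M T n + 7) * (Nat.log 2 (pN M T n) + 1)) := by rw [← pow_mul, Nat.mul_comm]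
    _ ≤ 2 ^ (aN M cT * n + aN M cT) := Nat.pow_le_pow_right (by norm_num) (expo_le M T cT hTb n)

include hTb in
/-- `h^K ≤ 2^{a_N n + a_N}` (the cube summed by the honest prover). [folklore] -/
theorem hN_pow_KN_le (n : ℕ) : hN M n ^ KN M T n ≤ 2 ^ (aN M cT * n + aN M cT) := by
  calc hN M n ^ KN M T n ≤ pN M T n ^ KN M T n := Nat.pow_le_pow_left (hN_lt_pN' M T n).le _
    _ ≤ pN M T n ^ (2 * KN M T n + mN M T n + 7) := Nat.pow_le_pow_right (pN_prime M T n).pos (by omega)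
    _ ≤ _ := pow_pN_le M T cT hTb n

include hTb in
/-- `T n ≤ 2^{a_N n + a_N}` (crudely, through `T n < h^{kt} ≤ p^{m}`). [folklore] -/
theorem T_le_budget (n : ℕ) : T n ≤ 2 ^ (aN M cT * n + aN M cT) := by
  have h1 : T n < hN M n ^ ktN M T n := by unfold ktN; exact Nat.lt_pow_succ_log_self (two_le_hN M n) _
  have h2 : hN M n ^ ktN M T n ≤ pN M T n ^ ktN M T n := Nat.pow_le_pow_left (hN_lt_pN' M T n).le _
  have h3 : pN M T n ^ ktN M T n ≤ pN M T n ^ (2 * KN M T n + mN M T n + 7) :=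
    Nat.pow_le_pow_right (pN_prime M T n).pos (by unfold mN mPt LN; dsimp only; omega)
  exact (h1.le.trans (h2.trans h3)).trans (pow_pN_le M T cT hTb n)

include hTb in
/-- `S₁ ≤ 2^{a_N n + a_N}` (the last block index of a row). [folklore] -/
theorem S1N_le_budget (n : ℕ) : S1N M T n ≤ 2 ^ (aN M cT * n + aN M cT) := by
  have h1 : S1N M T n < hN M n ^ kJN M T n := by unfold kJN; exact Nat.lt_pow_succ_log_self (two_le_hN M n) _
  have h2 : hN M n ^ kJN M T n ≤ pN M T n ^ kJN M T n := Nat.pow_le_pow_left (hN_lt_pN' M T n).le _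
  have h3 : pN M T n ^ kJN M T n ≤ pN M T n ^ (2 * KN M T n + mN M T n + 7) :=
    Nat.pow_le_pow_right (pN_prime M T n).pos (by unfold mN mPt LN; dsimp only; omega)
  exact (h1.le.trans (h2.trans h3)).trans (pow_pN_le M T cT hTb n)

end Expo

/-! ### The positions read -/

section Pos

variable (M : TM2ComputableAux Bool Bool) (T : ℕ → ℕ) {x : List Bool} (ρc : List Bool)

local notation "n" => x.length
local notation "p" => pN M T x.length
local notation "𝔽" => FF M T x.length
local notation "KK" => KN M T x.length
local notation "mm" => mN M T x.length
local notation "DD" => DN M T x.length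

/-- `K + 2 ≤ p`, `D + 1 ≤ p`, `b₀ ≤ p`. [folklore] -/
theorem small_le_pN : KK + 2 ≤ p ∧ DD + 1 ≤ p ∧ b0 M T n ≤ p := by
  have hB := BN_lt_pN M T n
  have hh := two_le_hN M n
  have hD1 : 1 ≤ DD := by unfold DN; omega
  have hK : KK + 2 ≤ BN M T n + 1 := by
    unfold BN
    have : KK ≤ KK * DD := Nat.le_mul_of_pos_right _ hD1
    omega
  have hD : DD ≤ BN M T n := by
    unfold BN
    have hK1 : 1 ≤ KK := by unfold KN KIdx LN ktN; dsimp only; omega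
    have : DD ≤ KK * DD := Nat.le_mul_of_pos_left _ hK1
    omega
  refine ⟨by omega, by omega, ?_⟩
  unfold b0
  exact Nat.succ_le_of_lt (Nat.log_lt_self 2 (pN_prime M T n).ne_zero)

/-- **The index of a message argument is `< p^{2K+1} (K + 2)`.** [folklore] -/
theorem sIdx_lt (ρ : Fin KK → 𝔽) (seed : 𝔽) {pref : List 𝔽} (h : pref.length ≤ KK) :
    sIdx M T n ρ seed pref < p ^ (2 * KK + 1) * (KK + 2) := by
  unfold sIdx
  have h1 := vecIdx_lt M T n ρ
  have h2 := vecIdx_lt M T n (prefVec M T n pref)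
  have h3 := ZMod.val_lt seed
  have hp : 1 ≤ p := (pN_prime M T n).one_lt.le
  have hA : vecIdx M T n ρ * p + seed.val < p ^ KK * p := by
    calc vecIdx M T n ρ * p + seed.val < vecIdx M T n ρ * p + p := by omega
      _ = (vecIdx M T n ρ + 1) * p := by ring
      _ ≤ p ^ KK * p := Nat.mul_le_mul_right _ h1
  have hB : (vecIdx M T n ρ * p + seed.val) * (KK + 1) + pref.length < p ^ KK * p * (KK + 1) + (KK + 1) := by
    have := Nat.mul_le_mul_right (KK + 1) hA
    nlinarith
  calc ((vecIdx M T n ρ * p + seed.val) * (KK + 1) + pref.length) * p ^ KK + vecIdx M T n (prefVec M T n pref)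
      < ((vecIdx M T n ρ * p + seed.val) * (KK + 1) + pref.length) * p ^ KK + p ^ KK := by omega
    _ = (((vecIdx M T n ρ * p + seed.val) * (KK + 1) + pref.length) + 1) * p ^ KK := by ring
    _ ≤ (p ^ KK * p * (KK + 1) + (KK + 1)) * p ^ KK := Nat.mul_le_mul_right _ hB
    _ ≤ (p ^ KK * p * (KK + 1) + p ^ KK * p * 1) * p ^ KK := by
        refine Nat.mul_le_mul_right _ (Nat.add_le_add_left ?_ _)
        rw [Nat.mul_one]
        calc KK + 1 ≤ p := by have := (small_le_pN M T (x := x)).1; omega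
          _ = 1 * p := (Nat.one_mul _).symm
          _ ≤ p ^ KK * p := Nat.mul_le_mul_right _ (Nat.one_le_pow _ _ hp)
    _ = p ^ (2 * KK + 1) * (KK + 2) := by ring

/-- **Every position read is below `p^{2K + m + 7}`.** [cite: BuhrmanFortnowPavan2004, Thm. 3.3] -/
theorem queries_lt : ∀ q ∈ queriesOf M T x ρc, q < p ^ (2 * KK + mm + 7) := by
  intro q hq
  obtain ⟨hK2, hD1, hb0⟩ := small_le_pN M T (x := x)
  have hp2 := two_le_pN M T n
  have hp : 1 ≤ p := by omega
  -- both kinds of positions are `< baseS + p^{2K+1}(K+2)(D+1) b₀`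
  have hbound : q < baseS M T n + p ^ (2 * KK + 1) * (KK + 2) * (DD + 1) * b0 M T n := by
    unfold queriesOf at hq
    split_ifs at hq with hg
    · rcases List.mem_append.1 hq with hq | hq
      · unfold ptQueries at hq
        obtain ⟨w, -, hw⟩ := List.mem_flatMap.1 hq
        obtain ⟨i, hi, rfl⟩ := List.mem_map.1 hw
        exact (posY_lt M T n w (List.mem_range.1 hi)).trans_le (Nat.le_add_right _ _)
      · unfold msgQueries msgArgs at hq
        obtain ⟨pref, hpref, hq⟩ := List.mem_flatMap.1 hq
        obtain ⟨i', hi', rfl⟩ := List.mem_map.1 hpref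
        obtain ⟨j, hj, hq⟩ := List.mem_flatMap.1 hq
        obtain ⟨i, hi, rfl⟩ := List.mem_map.1 hq
        have hjD := List.mem_range.1 hj
        have hib := List.mem_range.1 hi
        have hlen : ((List.ofFn (tapeOf M T x ρc).r).take i').length ≤ KK := by
          rw [List.length_take, List.length_ofFn]; exact min_le_right _ _
        have hs := sIdx_lt M T (tapeOf M T x ρc).ρ (tapeOf M T x ρc).seed hlen
        unfold posS
        have : sIdx M T n (tapeOf M T x ρc).ρ (tapeOf M T x ρc).seed ((List.ofFn (tapeOf M T x ρc).r).take i') * (DD + 1) + j <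
            p ^ (2 * KK + 1) * (KK + 2) * (DD + 1) := by nlinarith
        nlinarith
    · simp at hq
  refine hbound.trans_le ?_
  -- `baseS = p^m b₀ ≤ p^{m+1}` and `p^{2K+1}(K+2)(D+1) b₀ ≤ p^{2K+4}`; sum `≤ p^{2K+m+7}`
  unfold baseS
  have h1 : p ^ mm * b0 M T n ≤ p ^ (2 * KK + mm + 6) := by
    calc p ^ mm * b0 M T n ≤ p ^ mm * p := Nat.mul_le_mul_left _ hb0
      _ = p ^ (mm + 1) := (pow_succ _ _).symm
      _ ≤ p ^ (2 * KK + mm + 6) := Nat.pow_le_pow_right hp (by omega)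
  have h2 : p ^ (2 * KK + 1) * (KK + 2) * (DD + 1) * b0 M T n ≤ p ^ (2 * KK + mm + 6) := by
    calc p ^ (2 * KK + 1) * (KK + 2) * (DD + 1) * b0 M T n ≤ p ^ (2 * KK + 1) * p * p * p :=
          Nat.mul_le_mul (Nat.mul_le_mul (Nat.mul_le_mul_left _ hK2) hD1) hb0
      _ = p ^ (2 * KK + 4) := by ring
      _ ≤ p ^ (2 * KK + mm + 6) := Nat.pow_le_pow_right hp (by omega)
  calc p ^ mm * b0 M T n + p ^ (2 * KK + 1) * (KK + 2) * (DD + 1) * b0 M T n ≤ p ^ (2 * KK + mm + 6) + p ^ (2 * KK + mm + 6) :=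
        Nat.add_le_add h1 h2
    _ = 2 * p ^ (2 * KK + mm + 6) := by ring
    _ ≤ p * p ^ (2 * KK + mm + 6) := Nat.mul_le_mul_right _ hp2
    _ = p ^ (2 * KK + mm + 7) := by ring

end Pos

end ScaledPCP

end Literature.Computability.Complexity

end
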